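import Literature.NumberTheory.EllipticCurves.Rank1Residual.Predicates
import Literature.NumberTheory.EllipticCurves.HeegnerPointsKolyvaginPrimaryNoTorsionIrreducibleProofs
import Literature.NumberTheory.EllipticCurves.ModPImageScalarThreeProofs
import Literature.NumberTheory.GaloisRepresentations.ContinuousH1SahNoFixedVector
import Literature.NumberTheory.EllipticCurves.GeomPointsGaloisModule
import HarnessLib

/-!
# Class X9: the DISCHARGE INTERFACE for the IMAGE INPUTS of the Kolyvagin machinery
# (a non-trivial central homothety; no `p`-torsion over fields of generalised-dihedral type)

Print-tier cell `bsd-print-x9` (D-0131 (2), key `x9`), typer seat ty2, file E of the discharge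
interface (A = `X9/LeafDischarge`, B = `X10/LeafDischargeX10b`, C = `X9/LeafDischargeHeegner`,
D = `X9/LeafDischargeTwist`). Theorems only: no definition, no new named fact (D-0014 / D-0026).
The crux J of route PrintX9 (`HeegnerDivisibilityX9`, item stmt-BirchSwinnertonDyer-20392) is
Jetchev's divisibility of derived Heegner points at IRREDUCIBLE NON-surjective image; the printed
proof (Jetchev 2008 §§3–6, McCallum 1991 §§3–4, Gross 1991 §§4 and 9) uses the surjectivity of
`ρ̄_{E,p}` ("Hypothesis (∗)") only through finitely many image consequences, which Matar–Nekovář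
2019 Prop. 6.4/6.5 list as (C2)–(C6) and derive from irreducibility. Two of them are KERNEL
THEOREMS of the tree; this file reads them on the leaf predicate `Rank1Residual.ClassX9 W p`
(`p ≥ 5`, (irr), ¬(surj)) as dot-lemmas, so that the prover of the J-line closes them by name:

1. **A non-trivial central homothety in the image** (MN19 Prop. 5.15 / Prop. 6.5 for (C4) via Sah's
   lemma; Cha 2005 Thm. 7): `ClassX9.exists_homothety` — some `σ ∈ Γ_ℚ` acts on `E[p]` as a scalar
   `a ≠ 1` (tree THEOREM `WeierstrassCurve.exists_galoisRepTorsion_eq_smul_of_not_surjective`,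
   Serre's Prop. 15 + surjective determinant + complex conjugation); `ClassX9.exists_homothety_noFixedVector`
   — the same element as a scalar `a : ℤ` on the Galois module `E[p]` with NO non-zero fixed vector
   (the hypothesis shape of the tree's Sah lemmas `galoisCohomology.res_one_injective_of_forall_fixed_eq_zero`
   / `bijective_quotientInvariants_sub_self`). X10b twin at `p = 3`: `ClassX10.exists_homothety_three`
   (`a = −1`, tree `exists_galoisRepTorsion_eq_smul_of_not_surjective_three`).
2. **(C2) `E(K[c])[p] = 0`** (Gross Lemma 4.3 at irreducible image, MN19 Prop. 6.5): for a number
   field `L` of generalised-dihedral type relative to a normal subgroup `N ⊴ Γ_ℚ` inside the image of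
   `Γ_L` — `ClassX9.torsionBy_eq_bot_of_sq_mem` (every square of `Γ_ℚ` in `N · [Γ_ℚ, Γ_ℚ]`),
   `ClassX9.torsionBy_eq_bot_of_dihedral` (`A = Γ_K`, `τ` = complex conjugation: `τ² ∈ N`,
   `Γ_ℚ = A ∪ τA`, `τaτ⁻¹a ∈ N`), and the `p^M`-versions — from the tree THEOREM
   `torsionBy_eq_bot_of_sq_mem_of_hasIrreducibleModPGaloisRep` (file
   `HeegnerPointsKolyvaginPrimaryNoTorsionIrreducibleProofs`), with `p ≥ 5` and (irr) discharged from
   the class. Identifying `N = Γ_{K[c]}`, `A`, `τ` for the tree's `ringClassField K ι c` is class field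
   theory (Cox Thm. 9.18) and stays with the consumer, exactly as for the surjective sibling
   `torsionBy_eq_bot_of_normal_of_hasSurjectiveModNGaloisRep`. (No X10b twin: at `p = 3` the
   determinant character is quadratic and CM curves give counterexamples.)

Nothing here is a class theorem and nothing is asserted about any curve; X9 keeps its label.

## References

* [MatarNekovar2019] Prop. 6.4 (C2)/(C4), Prop. 6.5, Prop. 5.15, proof of Prop. 5.31 (8) (pp. 488, 496–498).
* [GrossLMS1991] Lemma 4.3 (p. 242). [McCallumLMS1991] §4 (5).
* [Cha2005] Thm. 7 (p. 158) (vanishing of `H¹(K(E[p^M])/K, E[p^M])` from a homothety).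
* [Serre1972] §2.4 Prop. 15, §2.6, §5.2 (iii). [Sah1968] Prop. 2.7 (b).
-/

set_option autoImplicit false

noncomputable section

open scoped Classical

universe u

open WeierstrassCurve Field Literature.NumberTheory.EllipticCurves
  Literature.NumberTheory.GaloisRepresentations

namespace Literature.NumberTheory.EllipticCurves.Rank1Residual

section X9

variable {W : WeierstrassCurve ℚ} [W.IsElliptic] [W.IsGloballyMinimal] {p : ℕ} [Fact p.Prime]

/-! ### 1. The central homothety -/

/-- **A Galois element acting on `E[p]` by a scalar `a ≠ 1`, on class X9** (`p ≥ 5`, (irr),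
¬(surj) discharged from the class; tree theorem
`WeierstrassCurve.exists_galoisRepTorsion_eq_smul_of_not_surjective`). This is MN19's "non-trivial
homothety in `ρ̄(G_ℚ)`" (Prop. 5.15), the input of Sah's lemma for (C4) and of Cha's Thm. 7.
[cite: Serre1972, §2.4 Prop. 15 and §2.6] [cite: MatarNekovar2019, Prop. 5.15 and Prop. 6.5 (p. 498)] -/
theorem ClassX9.exists_homothety (h : ClassX9 W p) :
    ∃ (σ : absoluteGaloisGroup ℚ) (a : ZMod p), a ≠ 1 ∧
      ∀ x : geomTorsion W p, Multiplicative.toAdd (galoisRepTorsion W p σ) x = a.val • x :=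
  W.exists_galoisRepTorsion_eq_smul_of_not_surjective p h.2.2.1 h.2.2.2.1 h.2.2.2.2.1

/-- **The central homothety as a scalar on the Galois module `E[p]` with no non-zero fixed vector**,
on class X9: `∃ z a, (∀ m, z•m = a•m) ∧ (∀ m, z•m = m → m = 0)` — the hypothesis shape of the tree's
Sah lemmas (`res_one_injective_of_forall_fixed_eq_zero`). A `p`-torsion vector fixed by the scalar
`a ≢ 1 (mod p)` is zero (`eq_zero_of_smul_eq_of_prime`). [cite: Sah1968, Prop. 2.7 (b)]
[cite: Serre1972, §2.4 Prop. 15 and §2.6] -/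
theorem ClassX9.exists_homothety_noFixedVector (h : ClassX9 W p) :
    ∃ (z : absoluteGaloisGroup ℚ) (a : ℤ),
      (∀ m : geomTorsion W (p : ℤ), W.torsionGaloisModule (p : ℤ) z m = a • m) ∧
      (∀ m : geomTorsion W (p : ℤ), W.torsionGaloisModule (p : ℤ) z m = m → m = 0) := by
  have hp : p.Prime := Fact.out
  obtain ⟨z, a, ha1, hz⟩ := h.exists_homothety
  have hz' : ∀ m : geomTorsion W (p : ℤ), W.torsionGaloisModule (p : ℤ) z m = (a.val : ℤ) • m :=
    fun m => by
    rw [WeierstrassCurve.torsionGaloisModule_apply_apply, ← WeierstrassCurve.galoisRepTorsion_apply,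
      hz m, natCast_zsmul]
  refine ⟨z, (a.val : ℤ), hz', fun m hm => ?_⟩
  have hdvd : ¬ (p : ℤ) ∣ (a.val : ℤ) - 1 := by
    intro hd
    apply ha1
    have h0 : (((a.val : ℤ) - 1 : ℤ) : ZMod p) = 0 := (ZMod.intCast_zmod_eq_zero_iff_dvd _ p).mpr hd
    rw [Int.cast_sub, Int.cast_natCast, ZMod.natCast_zmod_val, Int.cast_one, sub_eq_zero] at h0
    exact h0
  exact eq_zero_of_smul_eq_of_prime hp (AddSubgroup.torsionBy.nsmul m) hdvd ((hz' m).symm.trans hm)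

/-! ### 2. No `p`-torsion over fields of generalised-dihedral type ((C2): `E(K[c])[p] = 0`) -/

/-- **(C2) on class X9, core form: `E(L)[p] = 0`** for a number field `L` and a normal subgroup
`N ⊴ Γ_ℚ` contained in the image of `Γ_{L₀} → Γ_ℚ` for some model `L₀ ≃ L` in `Type`, such that every
square of `Γ_ℚ` lies in `N · [Γ_ℚ, Γ_ℚ]` (printed: `L = K[c]`, `N = Γ_{K[c]}`,
`Gal(K[c]/ℚ)^{ab} = Gal(K_gen/ℚ)` killed by `2`); `p ≥ 5` and (irr) from the class.
[cite: MatarNekovar2019, Prop. 6.4 (C2), Prop. 6.5 and proof of Prop. 5.31 (8) (pp. 496–498)]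
[cite: GrossLMS1991, Lemma 4.3 (p. 242)] -/
theorem ClassX9.torsionBy_eq_bot_of_sq_mem (h : ClassX9 W p) {L : Type u} [Field L] [NumberField L]
    {L₀ : Type} [Field L₀] [NumberField L₀] (e : L₀ ≃ₐ[ℚ] L)
    (N : Subgroup (absoluteGaloisGroup ℚ)) [N.Normal]
    (hN : ∀ n ∈ N, ∃ τ : absoluteGaloisGroup L₀, resGal (K := ℚ) L₀ τ = n)
    (hsq : ∀ g : absoluteGaloisGroup ℚ, g * g ∈ N ⊔ commutator (absoluteGaloisGroup ℚ)) :
    AddSubgroup.torsionBy (W.baseChange L).toAffine.Point (p : ℤ) = ⊥ :=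
  torsionBy_eq_bot_of_sq_mem_of_hasIrreducibleModPGaloisRep W e Fact.out h.2.2.1 h.2.2.2.1 N hN hsq

/-- **(C2) on class X9, generalised-dihedral form: `E(L)[p] = 0`** for `N ⊴ Γ_ℚ` inside the image of
`Γ_{L₀}`, `A ≤ Γ_ℚ` and `τ ∈ Γ_ℚ` with `τ² ∈ N`, `Γ_ℚ = A ∪ τA`, `τ a τ⁻¹ a ∈ N` for `a ∈ A`
(printed: `A = Γ_K`, `τ` = complex conjugation inverting `Gal(K[c]/K)`).
[cite: MatarNekovar2019, Prop. 6.4 (C2), Prop. 6.5 (pp. 497–498)] [cite: GrossLMS1991, Lemma 4.3 (p. 242)] -/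
theorem ClassX9.torsionBy_eq_bot_of_dihedral (h : ClassX9 W p) {L : Type u} [Field L] [NumberField L]
    {L₀ : Type} [Field L₀] [NumberField L₀] (e : L₀ ≃ₐ[ℚ] L)
    (N : Subgroup (absoluteGaloisGroup ℚ)) [N.Normal] (A : Subgroup (absoluteGaloisGroup ℚ))
    (τ : absoluteGaloisGroup ℚ)
    (hN : ∀ n ∈ N, ∃ σ : absoluteGaloisGroup L₀, resGal (K := ℚ) L₀ σ = n)
    (hτ : τ * τ ∈ N) (hcov : ∀ g : absoluteGaloisGroup ℚ, g ∈ A ∨ τ⁻¹ * g ∈ A)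
    (hinv : ∀ a ∈ A, τ * a * τ⁻¹ * a ∈ N) :
    AddSubgroup.torsionBy (W.baseChange L).toAffine.Point (p : ℤ) = ⊥ :=
  torsionBy_eq_bot_of_dihedral_of_hasIrreducibleModPGaloisRep W e Fact.out h.2.2.1 h.2.2.2.1 N A τ
    hN hτ hcov hinv

/-- **`E(L)[p^M] = 0` on class X9**, core form (McCallum §4 (5): uniqueness of `p^M`-division
points over `K[c]`). [cite: McCallumLMS1991, §4 (5)] [cite: MatarNekovar2019, Prop. 6.5 (p. 498)] -/
theorem ClassX9.torsionBy_pow_eq_bot_of_sq_mem (h : ClassX9 W p) {L : Type u} [Field L]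
    [NumberField L] {L₀ : Type} [Field L₀] [NumberField L₀] (e : L₀ ≃ₐ[ℚ] L)
    (N : Subgroup (absoluteGaloisGroup ℚ)) [N.Normal]
    (hN : ∀ n ∈ N, ∃ τ : absoluteGaloisGroup L₀, resGal (K := ℚ) L₀ τ = n)
    (hsq : ∀ g : absoluteGaloisGroup ℚ, g * g ∈ N ⊔ commutator (absoluteGaloisGroup ℚ)) (M : ℕ) :
    AddSubgroup.torsionBy (W.baseChange L).toAffine.Point ((p ^ M : ℕ) : ℤ) = ⊥ :=
  torsionBy_pow_eq_bot_of_sq_mem_of_hasIrreducibleModPGaloisRep W e Fact.out h.2.2.1 h.2.2.2.1 N hN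
    hsq M

/-- **`E(L)[p^M] = 0` on class X9**, generalised-dihedral form. [cite: McCallumLMS1991, §4 (5)]
[cite: MatarNekovar2019, Prop. 6.4 (C2), Prop. 6.5 (pp. 497–498)] -/
theorem ClassX9.torsionBy_pow_eq_bot_of_dihedral (h : ClassX9 W p) {L : Type u} [Field L]
    [NumberField L] {L₀ : Type} [Field L₀] [NumberField L₀] (e : L₀ ≃ₐ[ℚ] L)
    (N : Subgroup (absoluteGaloisGroup ℚ)) [N.Normal] (A : Subgroup (absoluteGaloisGroup ℚ))
    (τ : absoluteGaloisGroup ℚ)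
    (hN : ∀ n ∈ N, ∃ σ : absoluteGaloisGroup L₀, resGal (K := ℚ) L₀ σ = n)
    (hτ : τ * τ ∈ N) (hcov : ∀ g : absoluteGaloisGroup ℚ, g ∈ A ∨ τ⁻¹ * g ∈ A)
    (hinv : ∀ a ∈ A, τ * a * τ⁻¹ * a ∈ N) (M : ℕ) :
    AddSubgroup.torsionBy (W.baseChange L).toAffine.Point ((p ^ M : ℕ) : ℤ) = ⊥ :=
  torsionBy_pow_eq_bot_of_dihedral_of_hasIrreducibleModPGaloisRep W e Fact.out h.2.2.1 h.2.2.2.1 N A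
    τ hN hτ hcov hinv M

end X9

section X10b

variable {W : WeierstrassCurve ℚ} [W.IsElliptic] [W.IsGloballyMinimal] {p : ℕ} [Fact p.Prime]

/-- **A Galois element acting on `E[3]` by a scalar `a ≠ 1` (indeed `a = −1`), on class X10b**
(`p = 3`, (irr) from `ClassX10`, ¬(surj) the X10b hypothesis; tree theorem
`exists_galoisRepTorsion_eq_smul_of_not_surjective_three`). [cite: Serre1972, §2.4 Prop. 15 and §2.6] -/
theorem ClassX10.exists_homothety_three (h : ClassX10 W p) (hns : ¬ Surj W 3) :
    ∃ (σ : absoluteGaloisGroup ℚ) (a : ZMod p), a ≠ 1 ∧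
      ∀ x : geomTorsion W p, Multiplicative.toAdd (galoisRepTorsion W p σ) x = a.val • x := by
  obtain ⟨hp3, -, hirr, -⟩ := h
  subst hp3
  exact W.exists_galoisRepTorsion_eq_smul_of_not_surjective_three 3 rfl hirr hns

end X10b

end Literature.NumberTheory.EllipticCurves.Rank1Residual

end
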